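import Summits.QuantumFields.YangMills.Theorems.BalabanLadderNTReferenceTransfer
import HarnessLib

/-!
# Crux `NT` (stmt-QuantumFields-19353): reference-state transfer, II — the third cumulant of three action
# densities between DLR-consistent states (two-sided law of total cumulance, oscillation form)

Helper file (`--supports stmt-QuantumFields-19353`) of the fleet lead prover of crux `NT` (unit `ym-spine-19353-p1`,
g4); the «kerK3 two-sided law of total cumulance as a tree lemma» listed as open in the crux idea
`Cruxes/NT/Ideas/reference-state-transfer.md` (§Edisonian repair census, «Open → for crux-plan»).  Vocabulary of
`Theorems/LangevinControlUVOSLegsFromFemtoAndGapDefs.lean` (`dens`, `kerE`, `kerCov`, `kerK3`, `torusE`, `torusK3`,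
`depth`, `cubeEdges`); abstract law `Reference.abs_cum3_sub_integral_condCum3_le_of_osc` of the sibling file I.

For a transfer cube `P = (c₀, b₀)`, three sites `x, y, z`, and the EXTERIOR OSCILLATIONS of the `P`-kernel data
(`k_x ≥ sup_{ζ,ζ'} |kerE_P^ζ(dens x) − kerE_P^{ζ'}(dens x)|`, `w_{yz} ≥` the oscillation of `kerCov_P^ζ(dens y, dens z)`,
`ω₃ ≥` the oscillation of `kerK3_P^ζ(x,y,z)`; all sign-free):

* `abs_kerK3_sub_kerE_kerK3_le` — for `P ⊆ Q` and ONE exterior `η₀` of `Q`: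
  `|kerK3_Q^{η₀}(x,y,z) − kerE_Q^{η₀}[ζ ↦ kerK3_P^ζ(x,y,z)]| ≤ k_x w_{yz} + k_y w_{xz} + k_z w_{xy} + k_x k_y k_z`;
* `abs_torusK3_sub_torusE_kerK3_le` — for a torus of side `2L+1 ≥ b₀ + 3` and `x, y, z` of depth `≥ 1` in `P`:
  the same bound for `|torusK3_L(x,y,z) − torusE_L[kerK3_P^{lift ·}(x,y,z)]|`;
* `abs_torusK3_sub_kerK3_le` — **the reference-state transfer for the third cumulant**:
  `|torusK3_L(x,y,z) − kerK3_Q^{η₀}(x,y,z)| ≤ 2 (k_x w_{yz} + k_y w_{xz} + k_z w_{xy} + k_x k_y k_z) + ω₃` for EVERY `L`;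
* `abs_torusK3_sub_torusK3_le` — two tori of any sides `≥ b₀ + 3` differ by at most the same.

No sign of the cumulant is involved anywhere (contrast the signed floor form `kerK3_lower_of_nested` of
`…NTWeakPackageNestedCumulant.lean`): an |·|-floor on `kerK3` in ONE reference state passes to `|torusK3|` on every
torus.  Also here: `dens_supp_window_of_depth_pos` (a site of depth `≥ 1` carries its action density inside the
cube window) and the site-level covariance transfer `abs_torusCov_dens_sub_kerCov_dens_le`.

Refs: Brillinger 1969 (law of total cumulance); Georgii 2011 Thm. 4.17; card `reference-state-transfer` §Mechanism 4.
-/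

set_option autoImplicit false

noncomputable section

open MeasureTheory Filter Topology
open Literature.MathematicalPhysics.QuantumFieldTheory Literature.MathematicalPhysics.QuantumLattice
open Literature.Probability.LatticeModels
open Summit.QuantumFields.YangMills.Cruxes.OSLegsFromFemtoAndGap.DlrCollarTransfer
open Summit.QuantumFields.YangMills.Cruxes.OSLegsFromFemtoAndGap.DlrCollarTransfer.StubLower
  (isCylinder_mul isCylinder_dens exists_abs_dens_le)
open Summit.QuantumFields.YangMills.Theorems.OSLegsFromFemtoAndGap.StubLower (curvature_shift_supp_window)
open Summit.QuantumFields.YangMills.Cruxes.OSLegsAtWeakCouplingC.InheritedAmplitudeGates.StubInherit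
  (integral_lift_eq_integral_kerE_cube window_of_depth_pos)
open Summit.QuantumFields.YangMills.Cruxes.NT.BoundaryLaw (kerE_kerE_of_subset)

namespace Summit.QuantumFields.YangMills.Cruxes.NT.Reference

variable (G : Type) [Group G] [TopologicalSpace G] [IsTopologicalGroup G] [CompactSpace G]
  [MeasurableSpace G] [BorelSpace G] (r : LatticeRep G)

/-! ## §1 Windows -/

/-- A site of depth `≥ 1` in the cube `(c₀, b₀)` carries its action density inside the cube window: every base
point `e` of the translated curvature support satisfies `c₀ ≤ e ≤ c₀ + b₀` coordinatewise. [folklore] -/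
theorem dens_supp_window_of_depth_pos {c₀ : Fin 4 → ℤ} {b₀ : ℕ} {z : Fin 4 → ℤ} (hz : 1 ≤ depth c₀ b₀ z)
    (e : Literature.MathematicalPhysics.QuantumLattice.ZdEdge 4)
    (he : e ∈ r.curvature.supp.image fun e => (e.1 + z, e.2)) (j : Fin 4) :
    c₀ j ≤ e.1 j ∧ e.1 j ≤ c₀ j + b₀ := by
  have h1 := curvature_shift_supp_window r z e he j
  have h2 := window_of_depth_pos hz j
  constructor <;> linarith [h1.1, h1.2, h2.1, h2.2]

/-- Window of a union of supports. [folklore] -/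
theorem window_union {c₀ : Fin 4 → ℤ} {b₀ : ℕ}
    {S S' : Finset (Literature.MathematicalPhysics.QuantumLattice.ZdEdge 4)}
    (hS : ∀ e ∈ S, ∀ j, c₀ j ≤ e.1 j ∧ e.1 j ≤ c₀ j + b₀)
    (hS' : ∀ e ∈ S', ∀ j, c₀ j ≤ e.1 j ∧ e.1 j ≤ c₀ j + b₀) :
    ∀ e ∈ S ∪ S', ∀ j, c₀ j ≤ e.1 j ∧ e.1 j ≤ c₀ j + b₀ := fun e he j => by
  rcases Finset.mem_union.1 he with h | h
  · exact hS e h j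
  · exact hS' e h j

/-! ## §2 The site-level covariance transfer -/

/-- **Reference-state transfer for the covariance of two action densities.**  `P = (c₀,b₀) ⊆ Q`, ONE exterior
`η₀` of `Q`, a torus of any side `2L+1 ≥ b₀ + 3`, sites `x, y` of depth `≥ 1` in `P`; exterior oscillations `h_x, h_y`
of the `P`-kernel means and `ω` of the `P`-kernel covariance:
`|torusCov_L(dens x, dens y) − kerCov_Q^{η₀}(dens x, dens y)| ≤ 2 h_x h_y + ω`. [folklore] -/
theorem abs_torusCov_dens_sub_kerCov_dens_le (β : ℝ) {c c₀ : Fin 4 → ℤ} {b b₀ : ℕ}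
    (hsub : cubeEdges c₀ b₀ ⊆ cubeEdges c b) (η₀ : LGConfig 4 G) (L : ℕ) (hL : b₀ + 3 ≤ 2 * L + 1)
    {x y : Fin 4 → ℤ} (hx : 1 ≤ depth c₀ b₀ x) (hy : 1 ≤ depth c₀ b₀ y) {hx' hy' ω : ℝ}
    (hox : ∀ ζ ζ', |kerE G r β c₀ b₀ ζ (dens G r x) - kerE G r β c₀ b₀ ζ' (dens G r x)| ≤ hx')
    (hoy : ∀ ζ ζ', |kerE G r β c₀ b₀ ζ (dens G r y) - kerE G r β c₀ b₀ ζ' (dens G r y)| ≤ hy')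
    (hoC : ∀ ζ ζ', |kerCov G r β c₀ b₀ ζ (dens G r x) (dens G r y) -
      kerCov G r β c₀ b₀ ζ' (dens G r x) (dens G r y)| ≤ ω) :
    |(torusE G r β L (fun U => dens G r x U * dens G r y U) - torusE G r β L (dens G r x) * torusE G r β L (dens G r y))
      - kerCov G r β c b η₀ (dens G r x) (dens G r y)| ≤ 2 * hx' * hy' + ω := by
  obtain ⟨M, -, hM⟩ := exists_abs_dens_le G r
  exact abs_torusCov_sub_kerCov_le G r β hsub η₀ L hL (continuous_dens r x) (continuous_dens r y) (hM x) (hM y)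
    (isCylinder_dens G r x) (isCylinder_dens G r y) (dens_supp_window_of_depth_pos G r hx)
    (dens_supp_window_of_depth_pos G r hy) hox hoy hoC

/-! ## §3 The third cumulant -/

/-- **Reference kernel ↔ mean of sub-cube third cumulants (two-sided).**  `P = (c₀,b₀) ⊆ Q`, ONE exterior `η₀` of
`Q`, sites `x, y, z`; exterior oscillations `k_x, k_y, k_z` of the `P`-kernel means, `w_{yz}, w_{xz}, w_{xy}` of the
`P`-kernel covariances: `|kerK3_Q^{η₀}(x,y,z) − kerE_Q^{η₀}[ζ ↦ kerK3_P^ζ(x,y,z)]| ≤ k_x w_{yz} + k_y w_{xz} + k_z w_{xy}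
+ k_x k_y k_z` (consistency ×7 + `abs_cum3_sub_integral_condCum3_le_of_osc`). [folklore] -/
theorem abs_kerK3_sub_kerE_kerK3_le (β : ℝ) {c c₀ : Fin 4 → ℤ} {b b₀ : ℕ}
    (hsub : cubeEdges c₀ b₀ ⊆ cubeEdges c b) (η₀ : LGConfig 4 G) (x y z : Fin 4 → ℤ)
    {kx ky kz wyz wxz wxy : ℝ}
    (hox : ∀ ζ ζ', |kerE G r β c₀ b₀ ζ (dens G r x) - kerE G r β c₀ b₀ ζ' (dens G r x)| ≤ kx)
    (hoy : ∀ ζ ζ', |kerE G r β c₀ b₀ ζ (dens G r y) - kerE G r β c₀ b₀ ζ' (dens G r y)| ≤ ky)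
    (hoz : ∀ ζ ζ', |kerE G r β c₀ b₀ ζ (dens G r z) - kerE G r β c₀ b₀ ζ' (dens G r z)| ≤ kz)
    (hoyz : ∀ ζ ζ', |kerCov G r β c₀ b₀ ζ (dens G r y) (dens G r z) -
      kerCov G r β c₀ b₀ ζ' (dens G r y) (dens G r z)| ≤ wyz)
    (hoxz : ∀ ζ ζ', |kerCov G r β c₀ b₀ ζ (dens G r x) (dens G r z) -
      kerCov G r β c₀ b₀ ζ' (dens G r x) (dens G r z)| ≤ wxz)
    (hoxy : ∀ ζ ζ', |kerCov G r β c₀ b₀ ζ (dens G r x) (dens G r y) -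
      kerCov G r β c₀ b₀ ζ' (dens G r x) (dens G r y)| ≤ wxy) :
    |kerK3 G r β c b η₀ x y z - kerE G r β c b η₀ (fun ζ => kerK3 G r β c₀ b₀ ζ x y z)| ≤
      kx * wyz + ky * wxz + kz * wxy + kx * ky * kz := by
  haveI := r.secondCountableTopology
  haveI := isProbabilityMeasure_ymSpecification r.ρ r.continuous β (cubeEdges c b) η₀
  obtain ⟨M, -, hM⟩ := exists_abs_dens_le G r
  have cx := continuous_dens r x
  have cy := continuous_dens r y
  have cz := continuous_dens r z
  have cxy : Continuous fun U => dens G r x U * dens G r y U := cx.mul cy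
  have cxz : Continuous fun U => dens G r x U * dens G r z U := cx.mul cz
  have cyz : Continuous fun U => dens G r y U * dens G r z U := cy.mul cz
  have cxyz : Continuous fun U => dens G r x U * dens G r y U * dens G r z U := cxy.mul cz
  have bxy : ∀ U, |dens G r x U * dens G r y U| ≤ M * M := abs_mul_le_of_abs_le G (hM x) (hM y)
  have bxz : ∀ U, |dens G r x U * dens G r z U| ≤ M * M := abs_mul_le_of_abs_le G (hM x) (hM z)
  have byz : ∀ U, |dens G r y U * dens G r z U| ≤ M * M := abs_mul_le_of_abs_le G (hM y) (hM z)
  have bxyz : ∀ U, |dens G r x U * dens G r y U * dens G r z U| ≤ M * M * M :=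
    abs_mul_le_of_abs_le G bxy (hM z)
  -- consistency of the specification, seven times
  have E : ∀ {F : LGConfig 4 G → ℝ}, Continuous F → ∀ {C : ℝ}, (∀ U, |F U| ≤ C) →
      kerE G r β c b η₀ F = kerE G r β c b η₀ (fun ζ => kerE G r β c₀ b₀ ζ F) :=
    fun hF C hC => (kerE_kerE_of_subset G r β hsub η₀ hF.measurable hC).symm
  have key := abs_cum3_sub_integral_condCum3_le_of_osc
    (μ := ymSpecification (d := 4) r.ρ β (cubeEdges c b) η₀)
    (F₁ := fun ζ => kerE G r β c₀ b₀ ζ (dens G r x)) (F₂ := fun ζ => kerE G r β c₀ b₀ ζ (dens G r y))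
    (F₃ := fun ζ => kerE G r β c₀ b₀ ζ (dens G r z))
    (F₁₂ := fun ζ => kerE G r β c₀ b₀ ζ (fun U => dens G r x U * dens G r y U))
    (F₁₃ := fun ζ => kerE G r β c₀ b₀ ζ (fun U => dens G r x U * dens G r z U))
    (F₂₃ := fun ζ => kerE G r β c₀ b₀ ζ (fun U => dens G r y U * dens G r z U))
    (F₁₂₃ := fun ζ => kerE G r β c₀ b₀ ζ (fun U => dens G r x U * dens G r y U * dens G r z U))
    (continuous_kerE G r β c₀ b₀ cx (hM x)) (continuous_kerE G r β c₀ b₀ cy (hM y))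
    (continuous_kerE G r β c₀ b₀ cz (hM z)) (continuous_kerE G r β c₀ b₀ cxy bxy)
    (continuous_kerE G r β c₀ b₀ cxz bxz) (continuous_kerE G r β c₀ b₀ cyz byz)
    (continuous_kerE G r β c₀ b₀ cxyz bxyz) hox hoy hoz
    (fun ζ ζ' => by simpa only [kerCov] using hoyz ζ ζ')
    (fun ζ ζ' => by simpa only [kerCov] using hoxz ζ ζ')
    (fun ζ ζ' => by simpa only [kerCov] using hoxy ζ ζ')
  unfold kerK3
  rw [E cxyz bxyz, E cx (hM x), E cy (hM y), E cz (hM z), E cyz byz,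
    E cxz bxz, E cxy bxy]
  simp only [kerE] at key ⊢
  exact key

/-- **Torus ↔ mean of cube-kernel third cumulants (two-sided).**  A cube `P = (c₀, b₀)` inside a torus of side
`2L+1 ≥ b₀ + 3`, sites `x, y, z` of depth `≥ 1` in `P` (their densities are read inside the window), exterior
oscillations as above: `|torusK3_L(x,y,z) − torusE_L[kerK3_P^{lift ·}(x,y,z)]| ≤ k_x w_{yz} + k_y w_{xz} + k_z w_{xy} +
k_x k_y k_z` (torus DLR step ×7 + `abs_cum3_sub_integral_condCum3_le_of_osc`). [folklore] -/
theorem abs_torusK3_sub_torusE_kerK3_le (β : ℝ) (c₀ : Fin 4 → ℤ) (b₀ L : ℕ) (hL : b₀ + 3 ≤ 2 * L + 1)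
    {x y z : Fin 4 → ℤ} (hx : 1 ≤ depth c₀ b₀ x) (hy : 1 ≤ depth c₀ b₀ y) (hz : 1 ≤ depth c₀ b₀ z)
    {kx ky kz wyz wxz wxy : ℝ}
    (hox : ∀ ζ ζ', |kerE G r β c₀ b₀ ζ (dens G r x) - kerE G r β c₀ b₀ ζ' (dens G r x)| ≤ kx)
    (hoy : ∀ ζ ζ', |kerE G r β c₀ b₀ ζ (dens G r y) - kerE G r β c₀ b₀ ζ' (dens G r y)| ≤ ky)
    (hoz : ∀ ζ ζ', |kerE G r β c₀ b₀ ζ (dens G r z) - kerE G r β c₀ b₀ ζ' (dens G r z)| ≤ kz)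
    (hoyz : ∀ ζ ζ', |kerCov G r β c₀ b₀ ζ (dens G r y) (dens G r z) -
      kerCov G r β c₀ b₀ ζ' (dens G r y) (dens G r z)| ≤ wyz)
    (hoxz : ∀ ζ ζ', |kerCov G r β c₀ b₀ ζ (dens G r x) (dens G r z) -
      kerCov G r β c₀ b₀ ζ' (dens G r x) (dens G r z)| ≤ wxz)
    (hoxy : ∀ ζ ζ', |kerCov G r β c₀ b₀ ζ (dens G r x) (dens G r y) -
      kerCov G r β c₀ b₀ ζ' (dens G r x) (dens G r y)| ≤ wxy) :
    |torusK3 G r β L x y z - torusE G r β L (fun ζ => kerK3 G r β c₀ b₀ ζ x y z)| ≤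
      kx * wyz + ky * wxz + kz * wxy + kx * ky * kz := by
  classical
  haveI := r.secondCountableTopology
  haveI := isProbabilityMeasure_wilsonMeasure (d := 4) (L := 2 * L + 1) r.ρ r.continuous β
  obtain ⟨M, -, hM⟩ := exists_abs_dens_le G r
  have cx := continuous_dens r x
  have cy := continuous_dens r y
  have cz := continuous_dens r z
  have cxy : Continuous fun U => dens G r x U * dens G r y U := cx.mul cy
  have cxz : Continuous fun U => dens G r x U * dens G r z U := cx.mul cz
  have cyz : Continuous fun U => dens G r y U * dens G r z U := cy.mul cz
  have cxyz : Continuous fun U => dens G r x U * dens G r y U * dens G r z U := cxy.mul cz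
  have bxy : ∀ U, |dens G r x U * dens G r y U| ≤ M * M := abs_mul_le_of_abs_le G (hM x) (hM y)
  have bxz : ∀ U, |dens G r x U * dens G r z U| ≤ M * M := abs_mul_le_of_abs_le G (hM x) (hM z)
  have byz : ∀ U, |dens G r y U * dens G r z U| ≤ M * M := abs_mul_le_of_abs_le G (hM y) (hM z)
  have bxyz : ∀ U, |dens G r x U * dens G r y U * dens G r z U| ≤ M * M * M :=
    abs_mul_le_of_abs_le G bxy (hM z)
  have wx := dens_supp_window_of_depth_pos G r hx
  have wy := dens_supp_window_of_depth_pos G r hy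
  have wz := dens_supp_window_of_depth_pos G r hz
  -- the seven torus DLR steps
  have T : ∀ {F : LGConfig 4 G → ℝ}, Continuous F → ∀ {C : ℝ}, (∀ U, |F U| ≤ C) →
      ∀ {S : Finset (Literature.MathematicalPhysics.QuantumLattice.ZdEdge 4)}, IsCylinder F S →
      (∀ e ∈ S, ∀ j, c₀ j ≤ e.1 j ∧ e.1 j ≤ c₀ j + b₀) →
      ∫ U, F (torusLift (2 * L + 1) U) ∂(wilsonMeasure (d := 4) (L := 2 * L + 1) r.ρ β) =
        ∫ U, kerE G r β c₀ b₀ (torusLift (2 * L + 1) U) F ∂(wilsonMeasure (d := 4) (L := 2 * L + 1) r.ρ β) :=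
    fun hF C hC S hS hW => integral_lift_eq_integral_kerE_cube G r β c₀ b₀ (2 * L + 1) hL hF hC hS hW
  have ex := T cx (hM x) (isCylinder_dens G r x) wx
  have ey := T cy (hM y) (isCylinder_dens G r y) wy
  have ez := T cz (hM z) (isCylinder_dens G r z) wz
  have exy := T cxy bxy (isCylinder_mul (isCylinder_dens G r x) (isCylinder_dens G r y))
    (window_union wx wy)
  have exz := T cxz bxz (isCylinder_mul (isCylinder_dens G r x) (isCylinder_dens G r z))
    (window_union wx wz)
  have eyz := T cyz byz (isCylinder_mul (isCylinder_dens G r y) (isCylinder_dens G r z))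
    (window_union wy wz)
  have exyz := T cxyz bxyz
    (isCylinder_mul (isCylinder_mul (isCylinder_dens G r x) (isCylinder_dens G r y)) (isCylinder_dens G r z))
    (window_union (window_union wx wy) wz)
  have C : ∀ {F : LGConfig 4 G → ℝ}, Continuous F → ∀ {C : ℝ}, (∀ U, |F U| ≤ C) →
      Continuous fun U : GaugeConfig 4 (2 * L + 1) G => kerE G r β c₀ b₀ (torusLift (2 * L + 1) U) F :=
    fun hF C hC => continuous_kerE_torusLift G r β c₀ b₀ (2 * L + 1) hF hC
  have key := abs_cum3_sub_integral_condCum3_le_of_osc (μ := wilsonMeasure (d := 4) (L := 2 * L + 1) r.ρ β)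
    (C cx (hM x)) (C cy (hM y)) (C cz (hM z)) (C cxy bxy) (C cxz bxz) (C cyz byz)
    (C cxyz bxyz)
    (fun U V => hox _ _) (fun U V => hoy _ _) (fun U V => hoz _ _)
    (fun U V => by simpa only [kerCov] using hoyz (torusLift (2 * L + 1) U) (torusLift (2 * L + 1) V))
    (fun U V => by simpa only [kerCov] using hoxz (torusLift (2 * L + 1) U) (torusLift (2 * L + 1) V))
    (fun U V => by simpa only [kerCov] using hoxy (torusLift (2 * L + 1) U) (torusLift (2 * L + 1) V))
  simp only [torusK3, torusE]
  rw [exyz, ex, ey, ez, eyz, exz, exy]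
  simp only [kerK3] at key ⊢
  exact key

/-- **The reference-state transfer for the third cumulant (two-sided).**  `P = (c₀,b₀) ⊆ Q`, ONE exterior `η₀`
of `Q` (the reference state), a torus of ANY side `2L+1 ≥ b₀ + 3`, sites `x, y, z` of depth `≥ 1` in `P`; exterior
oscillations `k` (one-point), `w` (conditional covariances), `ω₃` (the conditional third cumulant) of the `P`-kernel
data.  Then `|torusK3_L(x,y,z) − kerK3_Q^{η₀}(x,y,z)| ≤ 2 (k_x w_{yz} + k_y w_{xz} + k_z w_{xy} + k_x k_y k_z) + ω₃` —
uniformly in `L`, with NO sign condition on the cumulant. [folklore] -/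
theorem abs_torusK3_sub_kerK3_le (β : ℝ) {c c₀ : Fin 4 → ℤ} {b b₀ : ℕ}
    (hsub : cubeEdges c₀ b₀ ⊆ cubeEdges c b) (η₀ : LGConfig 4 G) (L : ℕ) (hL : b₀ + 3 ≤ 2 * L + 1)
    {x y z : Fin 4 → ℤ} (hx : 1 ≤ depth c₀ b₀ x) (hy : 1 ≤ depth c₀ b₀ y) (hz : 1 ≤ depth c₀ b₀ z)
    {kx ky kz wyz wxz wxy ω₃ : ℝ}
    (hox : ∀ ζ ζ', |kerE G r β c₀ b₀ ζ (dens G r x) - kerE G r β c₀ b₀ ζ' (dens G r x)| ≤ kx)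
    (hoy : ∀ ζ ζ', |kerE G r β c₀ b₀ ζ (dens G r y) - kerE G r β c₀ b₀ ζ' (dens G r y)| ≤ ky)
    (hoz : ∀ ζ ζ', |kerE G r β c₀ b₀ ζ (dens G r z) - kerE G r β c₀ b₀ ζ' (dens G r z)| ≤ kz)
    (hoyz : ∀ ζ ζ', |kerCov G r β c₀ b₀ ζ (dens G r y) (dens G r z) -
      kerCov G r β c₀ b₀ ζ' (dens G r y) (dens G r z)| ≤ wyz)
    (hoxz : ∀ ζ ζ', |kerCov G r β c₀ b₀ ζ (dens G r x) (dens G r z) -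
      kerCov G r β c₀ b₀ ζ' (dens G r x) (dens G r z)| ≤ wxz)
    (hoxy : ∀ ζ ζ', |kerCov G r β c₀ b₀ ζ (dens G r x) (dens G r y) -
      kerCov G r β c₀ b₀ ζ' (dens G r x) (dens G r y)| ≤ wxy)
    (ho3 : ∀ ζ ζ', |kerK3 G r β c₀ b₀ ζ x y z - kerK3 G r β c₀ b₀ ζ' x y z| ≤ ω₃) :
    |torusK3 G r β L x y z - kerK3 G r β c b η₀ x y z| ≤
      2 * (kx * wyz + ky * wxz + kz * wxy + kx * ky * kz) + ω₃ := by
  haveI := r.secondCountableTopology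
  haveI := isProbabilityMeasure_wilsonMeasure (d := 4) (L := 2 * L + 1) r.ρ r.continuous β
  haveI := isProbabilityMeasure_ymSpecification r.ρ r.continuous β (cubeEdges c b) η₀
  obtain ⟨M, -, hM⟩ := exists_abs_dens_le G r
  have t1 := abs_torusK3_sub_torusE_kerK3_le G r β c₀ b₀ L hL hx hy hz hox hoy hoz hoyz hoxz hoxy
  have t2 := abs_kerK3_sub_kerE_kerK3_le G r β hsub η₀ x y z hox hoy hoz hoyz hoxz hoxy
  -- continuity of `ζ ↦ kerK3_P^ζ (x,y,z)`
  have cx := continuous_dens r x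
  have cy := continuous_dens r y
  have cz := continuous_dens r z
  have cxy : Continuous fun U => dens G r x U * dens G r y U := cx.mul cy
  have cxz : Continuous fun U => dens G r x U * dens G r z U := cx.mul cz
  have cyz : Continuous fun U => dens G r y U * dens G r z U := cy.mul cz
  have cxyz : Continuous fun U => dens G r x U * dens G r y U * dens G r z U := cxy.mul cz
  have bxy : ∀ U, |dens G r x U * dens G r y U| ≤ M * M := abs_mul_le_of_abs_le G (hM x) (hM y)
  have bxz : ∀ U, |dens G r x U * dens G r z U| ≤ M * M := abs_mul_le_of_abs_le G (hM x) (hM z)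
  have byz : ∀ U, |dens G r y U * dens G r z U| ≤ M * M := abs_mul_le_of_abs_le G (hM y) (hM z)
  have bxyz : ∀ U, |dens G r x U * dens G r y U * dens G r z U| ≤ M * M * M :=
    abs_mul_le_of_abs_le G bxy (hM z)
  have hcont : Continuous fun ζ => kerK3 G r β c₀ b₀ ζ x y z := by
    unfold kerK3
    have k1 := continuous_kerE G r β c₀ b₀ cx (hM x)
    have k2 := continuous_kerE G r β c₀ b₀ cy (hM y)
    have k3 := continuous_kerE G r β c₀ b₀ cz (hM z)
    have k12 := continuous_kerE G r β c₀ b₀ cxy bxy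
    have k13 := continuous_kerE G r β c₀ b₀ cxz bxz
    have k23 := continuous_kerE G r β c₀ b₀ cyz byz
    have k123 := continuous_kerE G r β c₀ b₀ cxyz bxyz
    exact (((k123.sub (k1.mul k23)).sub (k2.mul k13)).sub (k3.mul k12)).add
      (continuous_const.mul ((k1.mul k2).mul k3))
  have t3 : |torusE G r β L (fun ζ => kerK3 G r β c₀ b₀ ζ x y z) -
      kerE G r β c b η₀ (fun ζ => kerK3 G r β c₀ b₀ ζ x y z)| ≤ ω₃ := by
    unfold torusE kerE
    exact abs_integral_sub_integral_le_of_osc (hcont.comp (continuous_torusLift _)) hcont (fun U ζ => ho3 _ _)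
  have tri := abs_sub_le (torusK3 G r β L x y z) (torusE G r β L (fun ζ => kerK3 G r β c₀ b₀ ζ x y z))
    (kerK3 G r β c b η₀ x y z)
  have tri₂ := abs_sub_le (torusE G r β L (fun ζ => kerK3 G r β c₀ b₀ ζ x y z))
    (kerE G r β c b η₀ (fun ζ => kerK3 G r β c₀ b₀ ζ x y z)) (kerK3 G r β c b η₀ x y z)
  rw [abs_sub_comm] at t2
  linarith

/-- **Two tori compared, third cumulant.**  A cube `P` inside two tori of any sides `2L+1, 2L'+1 ≥ b₀ + 3`, sites of
depth `≥ 1` in `P`, oscillations as above: `|torusK3_L(x,y,z) − torusK3_{L'}(x,y,z)| ≤ 2 (k_x w_{yz} + k_y w_{xz} +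
k_z w_{xy} + k_x k_y k_z) + ω₃`. [folklore] -/
theorem abs_torusK3_sub_torusK3_le (β : ℝ) (c₀ : Fin 4 → ℤ) (b₀ L L' : ℕ) (hL : b₀ + 3 ≤ 2 * L + 1)
    (hL' : b₀ + 3 ≤ 2 * L' + 1)
    {x y z : Fin 4 → ℤ} (hx : 1 ≤ depth c₀ b₀ x) (hy : 1 ≤ depth c₀ b₀ y) (hz : 1 ≤ depth c₀ b₀ z)
    {kx ky kz wyz wxz wxy ω₃ : ℝ}
    (hox : ∀ ζ ζ', |kerE G r β c₀ b₀ ζ (dens G r x) - kerE G r β c₀ b₀ ζ' (dens G r x)| ≤ kx)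
    (hoy : ∀ ζ ζ', |kerE G r β c₀ b₀ ζ (dens G r y) - kerE G r β c₀ b₀ ζ' (dens G r y)| ≤ ky)
    (hoz : ∀ ζ ζ', |kerE G r β c₀ b₀ ζ (dens G r z) - kerE G r β c₀ b₀ ζ' (dens G r z)| ≤ kz)
    (hoyz : ∀ ζ ζ', |kerCov G r β c₀ b₀ ζ (dens G r y) (dens G r z) -
      kerCov G r β c₀ b₀ ζ' (dens G r y) (dens G r z)| ≤ wyz)
    (hoxz : ∀ ζ ζ', |kerCov G r β c₀ b₀ ζ (dens G r x) (dens G r z) -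
      kerCov G r β c₀ b₀ ζ' (dens G r x) (dens G r z)| ≤ wxz)
    (hoxy : ∀ ζ ζ', |kerCov G r β c₀ b₀ ζ (dens G r x) (dens G r y) -
      kerCov G r β c₀ b₀ ζ' (dens G r x) (dens G r y)| ≤ wxy)
    (ho3 : ∀ ζ ζ', |kerK3 G r β c₀ b₀ ζ x y z - kerK3 G r β c₀ b₀ ζ' x y z| ≤ ω₃) :
    |torusK3 G r β L x y z - torusK3 G r β L' x y z| ≤
      2 * (kx * wyz + ky * wxz + kz * wxy + kx * ky * kz) + ω₃ := by
  haveI := r.secondCountableTopology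
  haveI := isProbabilityMeasure_wilsonMeasure (d := 4) (L := 2 * L + 1) r.ρ r.continuous β
  haveI := isProbabilityMeasure_wilsonMeasure (d := 4) (L := 2 * L' + 1) r.ρ r.continuous β
  obtain ⟨M, -, hM⟩ := exists_abs_dens_le G r
  have t1 := abs_torusK3_sub_torusE_kerK3_le G r β c₀ b₀ L hL hx hy hz hox hoy hoz hoyz hoxz hoxy
  have t2 := abs_torusK3_sub_torusE_kerK3_le G r β c₀ b₀ L' hL' hx hy hz hox hoy hoz hoyz hoxz hoxy
  have cx := continuous_dens r x
  have cy := continuous_dens r y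
  have cz := continuous_dens r z
  have cxy : Continuous fun U => dens G r x U * dens G r y U := cx.mul cy
  have cxz : Continuous fun U => dens G r x U * dens G r z U := cx.mul cz
  have cyz : Continuous fun U => dens G r y U * dens G r z U := cy.mul cz
  have cxyz : Continuous fun U => dens G r x U * dens G r y U * dens G r z U := cxy.mul cz
  have bxy : ∀ U, |dens G r x U * dens G r y U| ≤ M * M := abs_mul_le_of_abs_le G (hM x) (hM y)
  have bxz : ∀ U, |dens G r x U * dens G r z U| ≤ M * M := abs_mul_le_of_abs_le G (hM x) (hM z)
  have byz : ∀ U, |dens G r y U * dens G r z U| ≤ M * M := abs_mul_le_of_abs_le G (hM y) (hM z)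
  have bxyz : ∀ U, |dens G r x U * dens G r y U * dens G r z U| ≤ M * M * M :=
    abs_mul_le_of_abs_le G bxy (hM z)
  have hcont : Continuous fun ζ => kerK3 G r β c₀ b₀ ζ x y z := by
    unfold kerK3
    have k1 := continuous_kerE G r β c₀ b₀ cx (hM x)
    have k2 := continuous_kerE G r β c₀ b₀ cy (hM y)
    have k3 := continuous_kerE G r β c₀ b₀ cz (hM z)
    have k12 := continuous_kerE G r β c₀ b₀ cxy bxy
    have k13 := continuous_kerE G r β c₀ b₀ cxz bxz
    have k23 := continuous_kerE G r β c₀ b₀ cyz byz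
    have k123 := continuous_kerE G r β c₀ b₀ cxyz bxyz
    exact (((k123.sub (k1.mul k23)).sub (k2.mul k13)).sub (k3.mul k12)).add
      (continuous_const.mul ((k1.mul k2).mul k3))
  have t3 : |torusE G r β L (fun ζ => kerK3 G r β c₀ b₀ ζ x y z) -
      torusE G r β L' (fun ζ => kerK3 G r β c₀ b₀ ζ x y z)| ≤ ω₃ := by
    unfold torusE
    exact abs_integral_sub_integral_le_of_osc (hcont.comp (continuous_torusLift _))
      (hcont.comp (continuous_torusLift _)) (fun U V => ho3 _ _)
  have tri := abs_sub_le (torusK3 G r β L x y z) (torusE G r β L (fun ζ => kerK3 G r β c₀ b₀ ζ x y z))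
    (torusK3 G r β L' x y z)
  have tri₂ := abs_sub_le (torusE G r β L (fun ζ => kerK3 G r β c₀ b₀ ζ x y z))
    (torusE G r β L' (fun ζ => kerK3 G r β c₀ b₀ ζ x y z)) (torusK3 G r β L' x y z)
  rw [abs_sub_comm] at t2
  linarith

end Summit.QuantumFields.YangMills.Cruxes.NT.Reference

end
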